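import Summits.AtomisticToContinuum.HydrodynamicLimit.Theorems.StiffCollisionalRelaxationAprioriBoundsEquilibriumPartOne
import Summits.AtomisticToContinuum.HydrodynamicLimit.Theorems.StiffCollisionalRelaxationAprioriBoundsCeilingChain
import Summits.AtomisticToContinuum.HydrodynamicLimit.Theorems.StiffCollisionalRelaxationAprioriBoundsCeilingStatics
import Summits.AtomisticToContinuum.HydrodynamicLimit.Theorems.StiffCollisionalRelaxationAprioriBoundsCeilingFixedHomogeneous
import Summits.AtomisticToContinuum.HydrodynamicLimit.Theorems.StiffCollisionalRelaxationAprioriBoundsFloorFixedHomogeneous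
import Summits.AtomisticToContinuum.HydrodynamicLimit.Theorems.StiffCollisionalRelaxationAprioriBoundsFloorStaticsTail
import Summits.AtomisticToContinuum.HydrodynamicLimit.Theorems.LocalSecondLaw.Negative.HomogeneousLLN
import Summits.AtomisticToContinuum.HydrodynamicLimit.Theorems.AprioriBounds.Negative.EquilibriumRung
import Literature.MathematicalPhysics.KineticTheory.HardSphereEulerLLN
import HarnessLib

/-!
# The equilibrium rung of the a-priori crux: component (ii) for every flow, and `EquilibriumAprioriBounds`

Supporting file of the line `Sketch` for the crux `AprioriBounds` (stmt-AtomisticToContinuum-14827;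
`Summit.AtomisticToContinuum.HydrodynamicLimit.Theses.StiffCollisionalRelaxation.AprioriBounds`), lead prover
`prover-line-stmt-AtomisticToContinuum-14827-c2-0` (wave 2, worker W6).  It serves the registered stubs
`stub_floorFixed`, `stub_coldJam`, `stub_hotJam` (component (ii) of the crux: "no mesoscopic cell is ever empty,
none is ever jammed") through their EQUILIBRIUM RUNG — the registered sub-goal `equilibriumAprioriBounds_unfolded`,
quantifier form of the headline `equilibriumAprioriBounds_holds`: it ASSEMBLES, from the landed pieces of the
wave, the disprover's `AprioriBoundsNegative.EquilibriumAprioriBounds` ("believed TRUE; unproved",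
`Negative/EquilibriumRung.lean`) — at the homogeneous local Gibbs data `(a₀, θ₀, u₀) = (1, θ₀, 0)`, for all
small `σ`, EVERY family of hard-sphere flows and EVERY horizon `t > 0`, components (i) and (ii) of the crux hold.

* `partTwoAt_equilibrium_at` — (ii) at one `σ` with `SmallDensity uniformProfile σ`, `σ ≤ 1/10`, given the
  `t = 0` law of large numbers of the flow family: for every admissible kernel family (`0 < γ ≤ 1/15`)
  (1) FLOOR: the fixed-`(s, x)` floor bound `floorFixed_homogeneous_of_static` (W3; its static input `H-low` is
      the landed lower-tail occupation bound `posGibbs_ballCount_le_le`, W4/W5), the energy cap `stub_energyCap`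
      fed by the LLN, the kinematic modulus `stub_blockModulus`, chained by `stub_floorChain` to the uniform floor
      at level `c₁/2`;
  (2) CEILING: the fixed-`(s, x)` packing bound `ceilingFixed_homogeneous_of_static` (W2; static input `H-up` =
      the Ruelle-factor Chernoff bound `posGibbs_sum_gt_le`, W1), chained by `ceilingChain` to the uniform
      level-`1` ceiling;
  (3) UNION: `{∃ s x, ρ̄ < c₁/2 ∨ 1 < ρ̄σ³} ⊆ {∃ s x, ρ̄ < c₁/2} ∪ {∃ s x, 1 < ρ̄σ³}` and a squeeze
      (`partTwo_union_tendsto`).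
* `partTwoAt_equilibrium` — the rung of (ii): `σ₀ := min (min σ₁ σ_S) (1/10)` with `σ₁` from the identified
  homogeneous LLN `LocalSecondLawNegative.homogeneous_lln_identified` and `σ_S` from `exists_smallDensity`.
* `equilibriumAprioriBounds_holds : AprioriBoundsNegative.EquilibriumAprioriBounds` — with c1's (i)-half
  `partOneAt_equilibrium` (`σ ≤ 1/2`); quantifier form `equilibriumAprioriBounds_unfolded`.

No new definitions, no named facts; axioms `propext`, `Classical.choice`, `Quot.sound`.
-/

noncomputable section

open MeasureTheory Filter Set Topology
open scoped ENNReal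

namespace Summit.AtomisticToContinuum.HydrodynamicLimit.Theorems.AdiabatCeiling

open Literature.MathematicalPhysics.KineticTheory Literature.Analysis.FluidPDE

/-! ## §1 The union step -/

/-- **Union step of (ii).**  For any laws `P_N`: if the uniform floor event `{∃ s ≤ t, ∃ x, ρ̄_N(s,x) < c₁}` and
the uniform ceiling event `{∃ s ≤ t, ∃ x, 1 < ρ̄_N(s,x)σ³}` both have `P_N`-probability `→ 0`, so does their
disjunction `{∃ s ≤ t, ∃ x, ρ̄_N(s,x) < c₁ ∨ 1 < ρ̄_N(s,x)σ³}` (it lies in the union; `measure_union_le`,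
squeeze against the sum). -/
theorem partTwo_union_tendsto {σ t c₁ : ℝ} {P : (N : ℕ) → Measure (Config (N + 1) (Fin 3) T3)}
    {Φ : (N : ℕ) → HardSphereFlow (Torus.geometry (Fin 3)) (hsDiameter σ N) (N + 1)} {φ : ℕ → T3 → ℝ}
    (hF : Tendsto (fun N : ℕ => P N {z | ∃ s ∈ Icc 0 t, ∃ x : T3,
      empiricalDensityField ((Φ N).flow s z) (fun y => φ N (y - x)) < c₁}) atTop (𝓝 0))
    (hCe : Tendsto (fun N : ℕ => P N {z | ∃ s ∈ Icc 0 t, ∃ x : T3,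
      1 < empiricalDensityField ((Φ N).flow s z) (fun y => φ N (y - x)) * σ ^ 3}) atTop (𝓝 0)) :
    Tendsto (fun N : ℕ => P N {z | ∃ s ∈ Icc 0 t, ∃ x : T3,
      empiricalDensityField ((Φ N).flow s z) (fun y => φ N (y - x)) < c₁ ∨
        1 < empiricalDensityField ((Φ N).flow s z) (fun y => φ N (y - x)) * σ ^ 3}) atTop (𝓝 0) := by
  have hsum := hF.add hCe
  rw [add_zero] at hsum
  refine tendsto_of_tendsto_of_tendsto_of_le_of_le tendsto_const_nhds hsum (fun _ => bot_le) fun N => ?_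
  refine (measure_mono ?_).trans (measure_union_le _ _)
  intro z hz
  simp only [Set.mem_setOf_eq, Set.mem_union] at hz ⊢
  obtain ⟨s, hs, x, hx⟩ := hz
  rcases hx with hlow | hjam
  · exact Or.inl ⟨s, hs, x, hlow⟩
  · exact Or.inr ⟨s, hs, x, hjam⟩

/-! ## §2 Component (ii) at equilibrium, at one reduced diameter -/

/-- **(ii) at homogeneous data, at one `σ`.**  Let `SmallDensity uniformProfile σ`, `σ ≤ 1/10`, `0 < θ₀`, let
`Φ` be ANY family of hard-sphere flows and assume the `t = 0` law of large numbers of the homogeneous local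
Gibbs laws `P_N = localGibbsLaw σ 1 0 θ₀ N (Φ N)` towards the constant fields `(1, 0, θ₀)`.  Then for every
`t > 0`, `PartTwoAt σ 1 θ₀ 0 Φ t`: for every admissible kernel family there is `c₁ > 0` with
`P_N{∃ s ≤ t, ∃ x, ρ̄_N(s,x) < c₁ ∨ 1 < ρ̄_N(s,x)σ³} → 0`.  FLOOR: `floorFixed_homogeneous_of_static` with
`hstat := posGibbs_ballCount_le_le` gives `P_N{ρ̄_N(Φ_s z, x) < c₁} ≤ δ_N`, `(N+1)²δ_N → 0`, at every fixed
`(s, x)`; `stub_energyCap` (from the LLN) and `stub_blockModulus` feed `stub_floorChain`, whence the uniform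
floor at level `c₁/2`.  CEILING: `ceilingFixed_homogeneous_of_static` with `hstat := posGibbs_sum_gt_le`, then
`ceilingChain`.  UNION: `partTwo_union_tendsto`, witness `c₁/2`. -/
theorem partTwoAt_equilibrium_at {σ θ₀ : ℝ} (hS : SmallDensity uniformProfile σ) (hσ10 : σ ≤ 1 / 10)
    (hθ : 0 < θ₀) (Φ : (N : ℕ) → HardSphereFlow (Torus.geometry (Fin 3)) (hsDiameter σ N) (N + 1))
    (hLLN : TendstoHydroFieldsAt
      (fun N => localGibbsLaw σ (fun _ => 1) (fun _ => 0) (fun _ => θ₀) N (Φ N)) Φ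
        (fun _ _ => (1 : ℝ)) (fun _ _ => (0 : V3)) (fun _ _ => θ₀) 0)
    {t : ℝ} (ht : 0 < t) :
    AprioriBoundsNegative.PartTwoAt σ (fun _ => 1) (fun _ => θ₀) (fun _ => 0) Φ t := by
  intro γ C φ hγ hγ' hadm
  have hσ : 0 < σ := hS.σ_pos
  have hσ2 : σ ≤ 1 / 2 := hS.σ_lt_half.le
  have hγ13 : γ < 1 / 3 := by linarith
  -- the two fixed-point bounds: floor (W3 fed by the floor statics W4/W5), ceiling (W2 fed by W1)
  obtain ⟨c₁, hc₁, δ, hδ, hfix⟩ := floorFixed_homogeneous_of_static hσ2 hθ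
    (fun N c r h2ε hr => posGibbs_ballCount_le_le hS hσ10 N c r h2ε hr) Φ hγ hγ13 hadm
  obtain ⟨δ', hδ', hfix'⟩ := ceilingFixed_homogeneous_of_static hσ hσ2 hθ
    (fun N _ hg _ hL hg0 hgL _ hK => posGibbs_sum_gt_le hS N hg hL hg0 hgL hK) Φ hγ hγ13 hadm
  -- the energy cap from the `t = 0` law of large numbers, and the kinematic modulus
  obtain ⟨K, hK, hcap⟩ := stub_energyCap (fun _ => 1) (fun _ => θ₀) (fun _ => 0) σ
    (fun _ _ => (1 : ℝ)) (fun _ _ => θ₀) (fun _ _ => (0 : V3)) Φ hLLN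
  have hC : 0 ≤ C := by
    have h0 := hadm.2.2.2.2.2 0 0
    simp only [Nat.cast_zero, zero_add, Real.one_rpow, mul_one] at h0
    exact (norm_nonneg _).trans h0
  have hmod : ∀ (N : ℕ), ∀ z ∈ (Φ N).good, configEnergy z ≤ K * ((N : ℝ) + 1) →
      ∀ (s s' : ℝ) (x x' : T3),
        |empiricalDensityField ((Φ N).flow s z) (fun y => φ N (y - x)) -
            empiricalDensityField ((Φ N).flow s' z) (fun y => φ N (y - x'))| ≤
          Real.sqrt 3 * (C * ((N : ℝ) + 1) ^ (4 * γ)) * (‖x - x'‖ + |s - s'| * Real.sqrt (2 * K)) :=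
    fun N z hz hE s s' x x' =>
      stub_blockModulus σ N (Φ N) (φ N) (C * ((N : ℝ) + 1) ^ (4 * γ)) K (hadm.1 N)
        (hadm.2.2.2.2.2 N) hK z hz hE s s' x x'
  -- chaining: the uniform floor at level `c₁ / 2` and the uniform ceiling at level `1`
  have hF := stub_floorChain σ Φ
    (fun N => localGibbsLaw σ (fun _ => 1) (fun _ => 0) (fun _ => θ₀) N (Φ N)) φ γ C t c₁ K δ
    hγ hγ' hC ht hc₁ hK hmod hcap hδ (fun N s _ x => hfix N s x)
  have hCe := ceilingChain σ Φ
    (fun N => localGibbsLaw σ (fun _ => 1) (fun _ => 0) (fun _ => θ₀) N (Φ N)) φ γ C t K δ'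
    hγ hγ' hC ht hK hσ.le hmod hcap hδ' (fun N s _ x => hfix' N s x)
  -- union
  exact ⟨c₁ / 2, half_pos hc₁, partTwo_union_tendsto hF hCe⟩

/-! ## §3 The equilibrium rung of (ii), and `EquilibriumAprioriBounds` -/

/-- **THE EQUILIBRIUM RUNG OF (ii), FOR EVERY FLOW.**  For every `θ₀ > 0` there is `σ₀ > 0` such that for
all `0 < σ < σ₀`, EVERY family `Φ` of hard-sphere flows of `N + 1` spheres of diameter `σ(N+1)^{-1/3}` on `𝕋³`
and EVERY horizon `t > 0`, component (ii) of the crux holds at the homogeneous local Gibbs data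
`(a₀, θ₀, u₀) = (1, θ₀, 0)`.  Witness `σ₀ := min (min σ₁ σ_S) (1/10)`: `σ₁ ≤ 1/2` from the identified
homogeneous `t = 0` law of large numbers (`homogeneous_lln_identified`, every flow family), `σ_S` from the
smallness threshold of the cluster expansion (`exists_smallDensity uniformProfile`), `1/10` for the floor
statics; then `partTwoAt_equilibrium_at`. -/
theorem partTwoAt_equilibrium {θ₀ : ℝ} (hθ : 0 < θ₀) :
    ∃ σ₀ : ℝ, 0 < σ₀ ∧ ∀ σ : ℝ, 0 < σ → σ < σ₀ →
      ∀ Φ : (N : ℕ) → HardSphereFlow (Torus.geometry (Fin 3)) (hsDiameter σ N) (N + 1),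
        ∀ t : ℝ, 0 < t → AprioriBoundsNegative.PartTwoAt σ (fun _ => 1) (fun _ => θ₀) (fun _ => 0) Φ t := by
  obtain ⟨σ₁, hσ₁, -, hL⟩ := LocalSecondLawNegative.homogeneous_lln_identified hθ
  obtain ⟨σS, hσS, hSm⟩ := exists_smallDensity uniformProfile one_pos
  refine ⟨min (min σ₁ σS) (1 / 10), lt_min (lt_min hσ₁ hσS) (by norm_num), fun σ hσ hσlt Φ t ht => ?_⟩
  have hσ1' : σ < σ₁ := hσlt.trans_le ((min_le_left _ _).trans (min_le_left _ _))
  have hσS' : σ < σS := hσlt.trans_le ((min_le_left _ _).trans (min_le_right _ _))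
  have hσ10 : σ ≤ 1 / 10 := (hσlt.trans_le (min_le_right _ _)).le
  exact partTwoAt_equilibrium_at (hSm σ hσ hσS').1 hσ10 hθ Φ (hL σ hσ hσ1' Φ) ht

/-- **THE EQUILIBRIUM RUNG OF THE CRUX HOLDS** (`AprioriBoundsNegative.EquilibriumAprioriBounds`, the
disprover's "believed TRUE; unproved" statement, now PROVED): for every `θ₀ > 0` there is `σ₀ > 0` such that
for all `0 < σ < σ₀`, every family of hard-sphere flows and every `t > 0`, components (i) AND (ii) of the
crux hold at the homogeneous local Gibbs data `(1, θ₀, 0)`.  (i): `partOneAt_equilibrium` (lead c1; every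
`σ ≤ 1/2`); (ii): `partTwoAt_equilibrium`; `σ₀ := min σ₀(ii) (1/2)`. -/
theorem equilibriumAprioriBounds_holds : AprioriBoundsNegative.EquilibriumAprioriBounds := by
  intro θ₀ hθ
  obtain ⟨σ₀, hσ₀, H⟩ := partTwoAt_equilibrium hθ
  refine ⟨min σ₀ (1 / 2), lt_min hσ₀ one_half_pos, fun σ hσ hσlt Φ t ht => ⟨?_, ?_⟩⟩
  · exact partOneAt_equilibrium (hσlt.trans_le (min_le_right _ _)).le hθ Φ ht
  · exact H σ hσ (hσlt.trans_le (min_le_left _ _)) Φ t ht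

/-- **The equilibrium rung, quantifier form** (`AprioriBoundsNegative.EquilibriumAprioriBounds` unfolded; the
shape registered on the crux item for this file): for every `θ₀ > 0` there is `σ₀ > 0` with
`PartOneAt σ 1 θ₀ 0 Φ t ∧ PartTwoAt σ 1 θ₀ 0 Φ t` for all `0 < σ < σ₀`, every flow family `Φ` and every
`t > 0` (`equilibriumAprioriBounds_holds`). -/
theorem equilibriumAprioriBounds_unfolded :
    ∀ θ₀ : ℝ, 0 < θ₀ → ∃ σ₀ : ℝ, 0 < σ₀ ∧ ∀ σ : ℝ, 0 < σ → σ < σ₀ →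
      ∀ Φ : (N : ℕ) → HardSphereFlow (Torus.geometry (Fin 3)) (hsDiameter σ N) (N + 1),
        ∀ t : ℝ, 0 < t →
          AprioriBoundsNegative.PartOneAt σ (fun _ => 1) (fun _ => θ₀) (fun _ => 0) Φ t ∧
            AprioriBoundsNegative.PartTwoAt σ (fun _ => 1) (fun _ => θ₀) (fun _ => 0) Φ t :=
  equilibriumAprioriBounds_holds

end Summit.AtomisticToContinuum.HydrodynamicLimit.Theorems.AdiabatCeiling

end
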